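import Summits.BirchSwinnertonDyer.BirchSwinnertonDyer.Theorems.EisensteinPrimesLineScalarsAtMultiplicativePlace
import Summits.BirchSwinnertonDyer.BirchSwinnertonDyer.Theorems.EisensteinPrimesGoodLatticeStableLineUnique
import Summits.BirchSwinnertonDyer.BirchSwinnertonDyer.Theorems.EisensteinPrimesResidualPairUnramifiedAtMultiplicative
import Summits.BirchSwinnertonDyer.BirchSwinnertonDyer.Theorems.EisensteinPrimesFullDescentMultiplicativeUnipotentLine
import Literature.NumberTheory.EllipticCurves.PAdicBSDSplitMultiplicativeProofs
import Literature.NumberTheory.EllipticCurves.SelmerCorankControlRatProofs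
import Literature.NumberTheory.GaloisRepresentations.ArtinFormalismInductionProofs
import HarnessLib

/-!
# The residual pair of the good lattice at a Frobenius above a MULTIPLICATIVE `ℓ ≠ p`: its scalars are
# `{a_ℓ·ℓ, a_ℓ}` (the K-level transfer of x2-p1-w7's Tate-curve dichotomy)

Cell `bsd-eis`, width seat `bsd-line-x1-p1-w2` gen 23, crux 2 `GoodLatticeBDPValue` (stmt-BirchSwinnertonDyer-19032), line
`halves` v33N; helper `--supports`, closes no stub. PROVED, no named fact, no `sorry`.

WHY. The (eq:Euler-comp) step of CGLS's proof of Thm. 2.2.2 needs, at each multiplicative `ℓ ∥ N`, the Frobenius values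
`{φ(ℓ), ψ(ℓ)} = {a_ℓ ℓ, a_ℓ}` of the residual characters (Tate curve; Greenberg–Vatsal §2 pp. 14–15). The content stub 3a-A
binds the pair over `K` (`IsResidualPairOver (W.baseChange K) p θsub θquot`); this file transfers the ℚ-level scalar
dichotomy (`…Theorems.LineScalarsAtMultiplicativePlace`, over x2-p1-w7's engine) to a Frobenius `σ₀ ∈ Γ_K` above `ℓ`:
* §1 scalar characters on `E[p](ℚ̄)`: uniqueness of the scalar mod `p` (`intCast_eq_val_quotActionChar`) and triviality
  of the quotient character on a unipotent element fixing the line (`quotActionChar_eq_one_of_unipotent`), over the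
  tree's `KellerYin2024.quotActionChar`;
* §2 `residualPair_scalars_transfer`: under the crux hypotheses (unique stable line, p740559) the integer scalars
  `(a, b)` of `σ₀` on the `K`-line `Φ` / on `E[p]/Φ` are scalars of `res σ₀ ∈ Γ_ℚ` on THE rational line / its quotient;
* §3 **`residualPair_frob_scalars_of_hasMultiplicativeReductionAtPrime`**: for `σ₀` an arithmetic Frobenius at `𝔓 ∣ w`,
  `f(w|ℓ) = 1`: `‖θsub(σ₀) − a‖ < 1`, `‖θquot(σ₀) − b‖ < 1` with `(ā, b̄) ∈ {(ℓ, 1), (1, ℓ)}` (split) resp.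
  `{(−ℓ, −1), (−1, −ℓ)}` (non-split, `ℓ` odd): `res σ₀` is a Frobenius above `ℓ`, `= i · g σ₁ g⁻¹` for x2-p1-w7's `σ₁` with
  `i` inertial, unipotent on `E[p]` (`smul_smul_sub_eq_of_mem_inertia_geomTorsion`), invisible to both scalar characters.

HONEST FRAMING: helper lemmas on the tree's own objects; 0 stubs / cells / labels / tiers move; orphan for -19032 until a
CGLS-2.2.1-shaped typing of 3a-A consumes it; no summit statement, no case of BSD, no crux or stub is proved here. The
non-split case keeps x2-p1-w7's `ℓ ≠ 2`. References: [GreenbergVatsal2000] §2 pp. 14–15; [SilvermanATAEC1994] V.3–V.5;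
[CastellaGrossiLeeSkinner2022] Thm. 2.2.1 / proof of Thm. 2.2.2; [KellerYin2024] §1.4; [NeukirchANT1999] Ch. I §9.
-/

set_option autoImplicit false
set_option linter.dupNamespace false

noncomputable section

open scoped Classical Pointwise

open NumberField IsDedekindDomain Field WeierstrassCurve
  Literature.NumberTheory.EllipticCurves Literature.NumberTheory.GaloisRepresentations
  Literature.NumberTheory.EllipticCurves.Rank1Residual
  Literature.NumberTheory.EllipticCurves.KellerYin2024
  Summit.BirchSwinnertonDyer.BirchSwinnertonDyer.Theorems.EisensteinPrimesLineCharactersAtMultiplicativePlace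

namespace Summit.BirchSwinnertonDyer.BirchSwinnertonDyer.Theorems.GoodLatticeResidualPairScalarsAtMultiplicative

variable {p : ℕ} [hp : Fact p.Prime]

/-! ## §1 Scalar characters of `Γ_ℚ` on a rational line and on its quotient -/
section Scalars
variable {W : WeierstrassCurve ℚ} [W.IsElliptic]

omit hp [W.IsElliptic] in
/-- Nothing moves `⊥`. [folklore] -/
theorem bot_stable (σ : absoluteGaloisGroup ℚ) :
    ∀ P ∈ (⊥ : AddSubgroup (geomTorsion W (p : ℤ))), σ • P ∈ (⊥ : AddSubgroup (geomTorsion W (p : ℤ))) := by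
  intro P hP; rw [AddSubgroup.mem_bot] at hP ⊢; rw [hP, smul_zero]

omit hp [W.IsElliptic] in
/-- Everything stays in `⊤`. [folklore] -/
theorem top_stable (σ : absoluteGaloisGroup ℚ) :
    ∀ P ∈ (⊤ : AddSubgroup (geomTorsion W (p : ℤ))), σ • P ∈ (⊤ : AddSubgroup (geomTorsion W (p : ℤ))) :=
  fun _ _ ↦ AddSubgroup.mem_top _

omit hp [W.IsElliptic] in
/-- `[Φ : ⊥] = p` for a line `Φ` of order `p`. [folklore] -/
theorem relIndex_bot_line {Φ : AddSubgroup (geomTorsion W (p : ℤ))} (hΦ : Nat.card Φ = p) :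
    (⊥ : AddSubgroup (geomTorsion W (p : ℤ))).relIndex Φ = p := by
  rw [AddSubgroup.relIndex_bot_left, hΦ]

/-- `[E[p] : Φ] = p` for a line `Φ` of order `p` (`#E[p] = p²`). [cite: SilvermanAEC2009, Cor. III.6.4(b)] -/
theorem relIndex_line_top {Φ : AddSubgroup (geomTorsion W (p : ℤ))} (hΦ : Nat.card Φ = p) :
    Φ.relIndex ⊤ = p := by
  haveI : CharZero (AlgebraicClosure ℚ) :=
    charZero_of_injective_algebraMap (algebraMap ℚ (AlgebraicClosure ℚ)).injective
  have hE : Nat.card (geomTorsion W (p : ℤ)) = p ^ 2 :=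
    card_torsionPoints_eq_sq_holds W (AlgebraicClosure ℚ) (Nat.cast_ne_zero.mpr hp.out.ne_zero)
  rw [AddSubgroup.relIndex_top_right]
  have h := Φ.index_mul_card
  rw [hΦ, hE, pow_two] at h
  exact Nat.eq_of_mul_eq_mul_right hp.out.pos h

/-- A line `Φ ≤ E[p]` of order `p` misses some point of `E[p]`. [cite: SilvermanAEC2009, Cor. III.6.4(b)] -/
theorem exists_not_mem_line {Φ : AddSubgroup (geomTorsion W (p : ℤ))} (hΦ : Nat.card Φ = p) :
    ∃ R : geomTorsion W (p : ℤ), R ∉ Φ := by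
  by_contra hall
  push Not at hall
  have htop : Φ = ⊤ := eq_top_iff.mpr fun R _ ↦ hall R
  have h := relIndex_line_top (W := W) hΦ
  rw [htop, AddSubgroup.relIndex_top_right, AddSubgroup.index_top] at h
  exact hp.out.one_lt.ne h

omit [W.IsElliptic] in
/-- A line of order `p` has a non-zero point. [folklore] -/
theorem exists_ne_zero_mem_line {Φ : AddSubgroup (geomTorsion W (p : ℤ))} (hΦ : Nat.card Φ = p) :
    ∃ P : geomTorsion W (p : ℤ), P ∈ Φ ∧ P ≠ 0 := by
  by_contra hall
  push Not at hall
  haveI : Subsingleton Φ := ⟨fun a b ↦ Subtype.ext ((hall a a.2).trans (hall b b.2).symm)⟩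
  have := hΦ ▸ Nat.card_of_subsingleton (0 : Φ)
  exact hp.out.one_lt.ne' this

omit [W.IsElliptic] in
/-- **Uniqueness of the scalar mod `p`**: if `σ • P − a • P ∈ N` for all `P ∈ T` and `T ⊄ N`, then `a` reduces to the
tree's `quotActionChar σ` on `T/N`. [cite: KellerYin2024, §1.4 (arXiv:2402.12781v2 TeX L1063–1086)] -/
theorem intCast_eq_val_quotActionChar {N T : AddSubgroup (geomTorsion W (p : ℤ))}
    (hN : ∀ g : absoluteGaloisGroup ℚ, ∀ P ∈ N, g • P ∈ N) (hT : ∀ g : absoluteGaloisGroup ℚ, ∀ P ∈ T, g • P ∈ T)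
    (hidx : N.relIndex T = p) {R : geomTorsion W (p : ℤ)} (hRT : R ∈ T) (hRN : R ∉ N)
    (σ : absoluteGaloisGroup ℚ) {a : ℤ} (ha : ∀ P ∈ T, σ • P - a • P ∈ N) :
    (a : ZMod p) = ((quotActionChar hN hT hidx σ : (ZMod p)ˣ) : ZMod p) := by
  set k : ℤ := (((quotActionChar hN hT hidx σ : (ZMod p)ˣ) : ZMod p).val : ℤ) with hk
  have hkR : σ • R - k • R ∈ N :=
    smul_sub_zsmul_mem hN hT hidx σ (by rw [hk, Int.cast_natCast, ZMod.natCast_zmod_val]) hRT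
  have hdiff : (k - a) • R ∈ N := by
    have e : (k - a) • R = (σ • R - a • R) - (σ • R - k • R) := by rw [sub_smul]; abel
    rw [e]; exact N.sub_mem (ha R hRT) hkR
  have hdvd : (p : ℤ) ∣ k - a := dvd_of_zsmul_mem_of_not_mem hRN hdiff
  have h0 : ((k - a : ℤ) : ZMod p) = 0 := (ZMod.intCast_zmod_eq_zero_iff_dvd _ p).mpr hdvd
  rw [Int.cast_sub, sub_eq_zero, hk, Int.cast_natCast, ZMod.natCast_zmod_val] at h0
  exact h0.symm

/-- **A unipotent element fixing the line acts trivially on the quotient**: if `i ∈ Γ_ℚ` satisfies `i(iQ − Q) = iQ − Q`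
on `E[p]` and fixes the line `Φ` pointwise, then its scalar on `E[p]/Φ` is `1`: writing `iR = bR + φ` for `R ∉ Φ`,
unipotence gives `(b − 1)² R ∈ Φ`, so `p ∣ b − 1`. [cite: SerreInventiones1972, §1.12] -/
theorem quotActionChar_eq_one_of_unipotent {Φ : AddSubgroup (geomTorsion W (p : ℤ))} (hΦ : IsRationalLine W p Φ)
    {i : absoluteGaloisGroup ℚ} (huni : ∀ Q : geomTorsion W (p : ℤ), i • (i • Q - Q) = i • Q - Q)
    (hfix : ∀ P ∈ Φ, i • P = P) :
    quotActionChar hΦ.2 top_stable (relIndex_line_top hΦ.1) i = 1 := by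
  obtain ⟨R, hRΦ⟩ := exists_not_mem_line (W := W) hΦ.1
  set χ := quotActionChar hΦ.2 top_stable (relIndex_line_top hΦ.1) with hχ
  set b : ℤ := (((χ i : (ZMod p)ˣ) : ZMod p).val : ℤ) with hb
  have hbR : i • R - b • R ∈ Φ :=
    smul_sub_zsmul_mem hΦ.2 top_stable (relIndex_line_top hΦ.1) i
      (by rw [hb, Int.cast_natCast, ZMod.natCast_zmod_val]) (AddSubgroup.mem_top R)
  have hiz : ∀ (k : ℤ) (x : geomTorsion W (p : ℤ)), i • (k • x) = k • (i • x) := fun k x ↦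
    map_zsmul (DistribSMul.toAddMonoidHom _ i) k x
  obtain ⟨φ₁, hφ₁Φ, hiR⟩ : ∃ φ₁ ∈ Φ, i • R = b • R + φ₁ := ⟨i • R - b • R, hbR, by abel⟩
  have hsqΦ : ((b - 1) * (b - 1)) • R ∈ Φ := by
    have h1 := huni R
    have e1 : i • R - R = (b - 1) • R + φ₁ := by rw [hiR, sub_smul, one_smul]; abel
    rw [e1, smul_add, hiz, hiR, hfix φ₁ hφ₁Φ, smul_add, smul_smul] at h1
    have h2 : ((b - 1) * b) • R + (b - 1) • φ₁ = (b - 1) • R := add_right_cancel h1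
    have h3 : ((b - 1) * b) • R - (b - 1) • R = -((b - 1) • φ₁) := by
      rw [sub_eq_iff_eq_add]; rw [← h2]; abel
    rw [show (b - 1) * (b - 1) = (b - 1) * b - (b - 1) by ring, sub_smul, h3]
    exact Φ.neg_mem (Φ.zsmul_mem hφ₁Φ _)
  have hdvd2 : (p : ℤ) ∣ (b - 1) * (b - 1) := dvd_of_zsmul_mem_of_not_mem hRΦ hsqΦ
  have hdvd : (p : ℤ) ∣ b - 1 := by
    rcases Int.Prime.dvd_mul' hp.out hdvd2 with h | h <;> exact h
  apply Units.ext
  rw [Units.val_one]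
  have h0 : ((b - 1 : ℤ) : ZMod p) = 0 := (ZMod.intCast_zmod_eq_zero_iff_dvd _ p).mpr hdvd
  rw [Int.cast_sub, Int.cast_one, sub_eq_zero, hb, Int.cast_natCast, ZMod.natCast_zmod_val] at h0
  exact h0

/-- **A unipotent element acts trivially on a rational line** (`(c − 1)² ≡ 0 ⇒ c ≡ 1`, tree
`FullDescentMultiplicativeUnipotentLine.lineCharacter_eq_one_of_unipotent`). [cite: SerreInventiones1972, §1.12] -/
theorem smul_eq_of_unipotent_of_mem_line {Φ : AddSubgroup (geomTorsion W (p : ℤ))} (hΦ : IsRationalLine W p Φ)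
    {i : absoluteGaloisGroup ℚ} (huni : ∀ Q : geomTorsion W (p : ℤ), i • (i • Q - Q) = i • Q - Q) :
    ∀ P ∈ Φ, i • P = P := by
  obtain ⟨P₀, hP₀Φ, hP₀0⟩ := exists_ne_zero_mem_line (W := W) hΦ.1
  set χ := quotActionChar bot_stable hΦ.2 (relIndex_bot_line hΦ.1) with hχ
  have hr : ∀ σ : absoluteGaloisGroup ℚ, ∀ P ∈ Φ, σ • P = (((χ σ : (ZMod p)ˣ) : ZMod p).val) • P :=
    fun σ P hP ↦ by
      have h := smul_sub_zsmul_mem bot_stable hΦ.2 (relIndex_bot_line hΦ.1) σ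
        (a := ((((χ σ : (ZMod p)ˣ) : ZMod p).val : ℕ) : ℤ))
        (by rw [Int.cast_natCast, ZMod.natCast_zmod_val]) hP
      rw [AddSubgroup.mem_bot, sub_eq_zero, natCast_zsmul] at h
      exact h
  have h1 : χ i = 1 :=
    FullDescentMultiplicativeUnipotentLine.lineCharacter_eq_one_of_unipotent W p hP₀0 (r := χ)
      (fun σ ↦ hr σ P₀ hP₀Φ) (huni P₀)
  intro P hP
  rw [hr i P hP, h1, Units.val_one, ZMod.val_one, one_smul]

end Scalars

/-! ## §2 Transfer of the scalars of `σ ∈ Γ_K` on the `K`-line to `res σ ∈ Γ_ℚ` on the rational line -/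
section Transfer
variable (W : WeierstrassCurve ℚ) [W.IsElliptic] [W.IsGloballyMinimal] (K : Type) [Field K] [NumberField K]
  {S : Set (PadicAlgCl p)}

/-- **The scalars of `σ ∈ Γ_K` on the residual pair are scalars of `res σ` on the rational line**: under the crux
hypotheses the stable line of a residual pair over `K` is the transport `e(Φ_ℚ)` of any rational line along the
`res`-equivariant `e = RatClosure.pointsEquiv` (`GoodLatticeStableLineUnique.eq_of_stable_baseChange`).
[cite: KellerYin2024, §1.4 display (char to f) (arXiv:2402.12781v2 TeX L1066–1086)] -/
theorem residualPair_scalars_transfer (hp2 : 2 < p) (hred : Red W p) (hanom : Anom W p)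
    (hlat : ∀ Φ : AddSubgroup (geomTorsion W (p : ℤ)), IsRationalLine W p Φ → ¬ LineUnramifiedAt W p Φ)
    (hK : IsImaginaryQuadratic K) (hHp : SatisfiesHeegnerHypothesis p K)
    {θsub θquot : FramedGaloisRep K (padicCoeffIntegers S) 1} (h : IsResidualPairOver (W.baseChange K) p θsub θquot)
    {Φ₀ : AddSubgroup (geomTorsion W (p : ℤ))} (hΦ₀ : IsRationalLine W p Φ₀) (σ : absoluteGaloisGroup K) :
    ∃ a b : ℤ,
      ‖((entry S θsub σ : padicCoeffIntegers S) : PadicAlgCl p) - (a : PadicAlgCl p)‖ < 1 ∧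
      ‖((entry S θquot σ : padicCoeffIntegers S) : PadicAlgCl p) - (b : PadicAlgCl p)‖ < 1 ∧
      (∀ P ∈ Φ₀, absGaloisRestrict ℚ K σ • P = a • P) ∧
      (∀ Q : geomTorsion W (p : ℤ), absGaloisRestrict ℚ K σ • Q - b • Q ∈ Φ₀) := by
  obtain ⟨Φ, hcard, hle, hstab, hsub, hquot⟩ := h
  set e : geomPoints W ≃+ geomPoints (W.baseChange K) := RatClosure.pointsEquiv (K := K) W with he
  -- the transported rational line
  set Φ' : AddSubgroup (geomPoints (W.baseChange K)) :=
    (Φ₀.map (geomTorsion W (p : ℤ)).subtype).map e.toAddMonoidHom with hΦ'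
  have hmem' : ∀ P : geomTorsion W (p : ℤ), P ∈ Φ₀ → e (P : geomPoints W) ∈ Φ' := fun P hP ↦
    ⟨(P : geomPoints W), ⟨P, hP, rfl⟩, rfl⟩
  have hmem'_iff : ∀ x : geomPoints (W.baseChange K), x ∈ Φ' ↔
      ∃ P : geomTorsion W (p : ℤ), P ∈ Φ₀ ∧ e (P : geomPoints W) = x := fun x ↦
    ⟨by rintro ⟨y, ⟨P, hP, rfl⟩, rfl⟩; exact ⟨P, hP, rfl⟩, by rintro ⟨P, hP, rfl⟩; exact hmem' P hP⟩
  have hcard' : Nat.card Φ' = p := by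
    rw [hΦ', Nat.card_congr ((Φ₀.map (geomTorsion W (p : ℤ)).subtype).equivMapOfInjective e.toAddMonoidHom
      e.injective).toEquiv.symm,
      Nat.card_congr (Φ₀.equivMapOfInjective (geomTorsion W (p : ℤ)).subtype
        (geomTorsion W (p : ℤ)).subtype_injective).toEquiv.symm, hΦ₀.1]
  have hle' : Φ' ≤ geomTorsion (W.baseChange K) (p : ℤ) := by
    intro x hx
    obtain ⟨P, -, rfl⟩ := (hmem'_iff x).mp hx
    rw [mem_geomTorsion_iff, ← map_zsmul, (mem_geomTorsion_iff W (p : ℤ) _).mp P.2, map_zero]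
  have hstab' : ∀ τ : absoluteGaloisGroup K, ∀ x ∈ Φ', τ • x ∈ Φ' := by
    intro τ x hx
    obtain ⟨P, hP, rfl⟩ := (hmem'_iff x).mp hx
    rw [← RatClosure.pointsEquiv_smul, ← AddSubgroup.torsionBy.coe_smul]
    exact hmem' _ (hΦ₀.2 _ P hP)
  -- uniqueness of the stable line: `Φ = Φ'`
  have hord : ¬ (p : ℤ) ∣ W.frobeniusTrace p := fun hdvd ↦ by
    have h1 : (p : ℤ) ∣ 1 := by
      have := dvd_sub hdvd hanom.2.2
      rwa [sub_sub_cancel] at this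
    have hp1 : (p : ℤ) ≤ 1 := Int.le_of_dvd one_pos h1
    have : (2 : ℤ) < p := by exact_mod_cast hp2
    omega
  have hΦΦ' : Φ = Φ' :=
    GoodLatticeStableLineUnique.eq_of_stable_baseChange W K hp2.ne' hanom.2.1 hord hlat hred hK hHp
      hcard hle hstab hcard' hle' hstab'
  -- the scalars
  obtain ⟨a, ha, haΦ⟩ := hsub.2 σ
  obtain ⟨b, hb, hbΦ⟩ := hquot.2 σ
  refine ⟨a, b, ha, hb, fun P hP ↦ ?_, fun Q ↦ ?_⟩
  · -- on the line
    have h1 : σ • e (P : geomPoints W) = a • e (P : geomPoints W) :=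
      sub_eq_zero.mp (AddSubgroup.mem_bot.mp (haΦ _ (hΦΦ' ▸ hmem' P hP)))
    rw [← RatClosure.pointsEquiv_smul, ← map_zsmul] at h1
    exact Subtype.ext (by
      rw [AddSubgroup.torsionBy.coe_smul, AddSubgroupClass.coe_zsmul]; exact e.injective h1)
  · -- on the quotient
    have hQ' : e (Q : geomPoints W) ∈ geomTorsion (W.baseChange K) (p : ℤ) := by
      rw [mem_geomTorsion_iff, ← map_zsmul, (mem_geomTorsion_iff W (p : ℤ) _).mp Q.2, map_zero]
    have h1 := hbΦ _ hQ'
    rw [hΦΦ', ← RatClosure.pointsEquiv_smul, ← map_zsmul, ← map_sub, hmem'_iff] at h1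
    obtain ⟨P, hP, hPe⟩ := h1
    have hPQ : (P : geomPoints W) = absGaloisRestrict ℚ K σ • (Q : geomPoints W) - b • (Q : geomPoints W) :=
      e.injective hPe
    have : P = absGaloisRestrict ℚ K σ • Q - b • Q := Subtype.ext (by
      rw [hPQ, AddSubgroupClass.coe_sub, AddSubgroup.torsionBy.coe_smul, AddSubgroupClass.coe_zsmul])
    rw [← this]
    exact hP

end Transfer

/-! ## §3 The scalars of a Frobenius above a multiplicative `ℓ ≠ p` on the residual pair -/
section Frobenius
variable (W : WeierstrassCurve ℚ) [W.IsElliptic] [W.IsGloballyMinimal] (K : Type) [Field K] [NumberField K]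
  {S : Set (PadicAlgCl p)}

/-- **The residual pair of the good lattice at a Frobenius above a multiplicative `ℓ ≠ p` has scalars `{a_ℓ ℓ, a_ℓ}`.**
`W/ℚ` globally minimal, `2 < p`, `Red`, `Anom`, (hlat), `K` imaginary quadratic with `p` split, `(θsub, θquot)` a residual
pair over `K`, `ℓ ≠ p` multiplicative, `w ∋ ℓ` of residue degree one, `𝔓 ∣ w`, `σ₀` an arithmetic Frobenius at `𝔓`:
the integer scalars `a, b` of `σ₀` (`‖θsub(σ₀) − a‖ < 1`, `‖θquot(σ₀) − b‖ < 1`) satisfy: split ⇒ `(ā, b̄) = (ℓ, 1)` or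
`(1, ℓ)`; non-split, `ℓ` odd ⇒ `(−ℓ, −1)` or `(−1, −ℓ)`. (§2; `res σ₀` is a Frobenius at `ι⁻¹𝔓 ∣ ℓ` as `N w = ℓ`;
x2-p1-w7's dichotomy at `σ₁`; `res σ₀ = i · g σ₁ g⁻¹` with `i` inertial, unipotent, invisible to the scalars, §1.)
[cite: GreenbergVatsal2000, §2 pp. 14–15] [cite: CastellaGrossiLeeSkinner2022, Thm. 2.2.1 (a_ℓ ≡ φ(ℓ), ψ(ℓ) at ℓ ∥ N) and proof of Thm. 2.2.2 (eq:Euler-comp)]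
[cite: KellerYin2024, §1.4 display (char to f) (arXiv:2402.12781v2 TeX L1066–1086)] -/
theorem residualPair_frob_scalars_of_hasMultiplicativeReductionAtPrime (hp2 : 2 < p) (hred : Red W p)
    (hanom : Anom W p)
    (hlat : ∀ Φ : AddSubgroup (geomTorsion W (p : ℤ)), IsRationalLine W p Φ → ¬ LineUnramifiedAt W p Φ)
    (hK : IsImaginaryQuadratic K) (hHp : SatisfiesHeegnerHypothesis p K)
    {θsub θquot : FramedGaloisRep K (padicCoeffIntegers S) 1} (h : IsResidualPairOver (W.baseChange K) p θsub θquot)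
    {ℓ : ℕ} [hℓ : Fact ℓ.Prime] (hℓp : ℓ ≠ p) (hmult : W.HasMultiplicativeReductionAtPrime ℓ)
    {w : HeightOneSpectrum (𝓞 K)} (hw : ((ℓ : ℕ) : 𝓞 K) ∈ w.asIdeal) (hf : w.asIdeal.inertiaDeg (𝓞 ℚ) = 1)
    {𝔓 : Ideal (absIntegers (𝓞 K) K)} (h𝔓 : 𝔓 ∈ w.primesAbove) {σ₀ : absoluteGaloisGroup K}
    (hσ₀ : IsArithFrobAt (𝓞 K) σ₀ 𝔓) :
    ∃ a b : ℤ,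
      ‖((entry S θsub σ₀ : padicCoeffIntegers S) : PadicAlgCl p) - (a : PadicAlgCl p)‖ < 1 ∧
      ‖((entry S θquot σ₀ : padicCoeffIntegers S) : PadicAlgCl p) - (b : PadicAlgCl p)‖ < 1 ∧
      (W.HasSplitMultiplicativeReductionAtPrime ℓ →
        ((a : ZMod p) = (ℓ : ZMod p) ∧ (b : ZMod p) = 1) ∨ ((a : ZMod p) = 1 ∧ (b : ZMod p) = (ℓ : ZMod p))) ∧
      (¬ W.HasSplitMultiplicativeReductionAtPrime ℓ → ℓ ≠ 2 →
        ((a : ZMod p) = -(ℓ : ZMod p) ∧ (b : ZMod p) = -1) ∨ ((a : ZMod p) = -1 ∧ (b : ZMod p) = -(ℓ : ZMod p))) := by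
  have hpp := hp.out
  -- the rational line and the transferred scalars of `res σ₀`
  obtain ⟨Φ₀, hΦ₀⟩ := exists_isRationalLine_of_not_irr (W := W) (p := p) hred
  obtain ⟨a, b, ha, hb, haΦ, hbΦ⟩ := residualPair_scalars_transfer W K hp2 hred hanom hlat hK hHp h hΦ₀ σ₀
  refine ⟨a, b, ha, hb, ?_⟩
  -- the place `v ∋ ℓ` of `ℚ` below `w`, multiplicative, `p ∉ v`
  let v : HeightOneSpectrum (𝓞 ℚ) := w.under (𝓞 ℚ)
  have hwv : w.asIdeal.under (𝓞 ℚ) = v.asIdeal := rfl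
  have hℓv : ((ℓ : ℕ) : 𝓞 ℚ) ∈ v.asIdeal := by
    change ((ℓ : ℕ) : 𝓞 ℚ) ∈ w.asIdeal.comap (algebraMap (𝓞 ℚ) (𝓞 K))
    rw [Ideal.mem_comap, map_natCast]; exact hw
  have hvℓ : ((Rat.HeightOneSpectrum.primesEquiv v : Nat.Primes) : ℕ) = ℓ :=
    Rat.HeightOneSpectrum.primesEquiv_eq_of_natCast_mem v hℓ.out hℓv
  have hmultv : W.HasMultiplicativeReductionAt v :=
    Summit.BirchSwinnertonDyer.Rank1Residual.X2.GreenbergVatsalStrictSelmerMultiplicative.hasMultiplicativeReductionAt_of_mem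
      W ℓ hmult hℓv
  have hpv : ((p : ℕ) : 𝓞 ℚ) ∉ v.asIdeal :=
    ResidualPairUnramifiedAtMultiplicative.not_natCast_mem_of_natCast_mem_of_ne hℓ.out hpp hℓp hℓv
  -- `res σ₀` is an arithmetic Frobenius at `𝔔 = ι⁻¹ 𝔓 ∣ v`
  set 𝔔 : Ideal (absIntegers (𝓞 ℚ) ℚ) := 𝔓.comap (absIntegersMap ℚ K) with h𝔔def
  have h𝔔 : 𝔔 ∈ v.primesAbove := comap_absIntegersMap_mem_primesAbove hwv h𝔓
  have hres : IsArithFrobAt (𝓞 ℚ) (absGaloisRestrict ℚ K σ₀) 𝔔 := by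
    rw [HeightOneSpectrum.isArithFrobAt_iff_of_mem_primesAbove h𝔔]
    have hq : w.residueCard = v.residueCard := by
      rw [residueCard_eq_pow_inertiaDeg_of_under_eq hwv, hf, pow_one]
    rw [← hq, h𝔔def, forall_smul_sub_pow_mem_comap_iff]
    exact (HeightOneSpectrum.isArithFrobAt_iff_of_mem_primesAbove h𝔓 σ₀).mp hσ₀
  -- scalar characters of `Γ_ℚ` on `Φ₀` and on `E[p]/Φ₀`
  set χl := quotActionChar bot_stable hΦ₀.2 (relIndex_bot_line hΦ₀.1) with hχl
  set χq := quotActionChar hΦ₀.2 top_stable (relIndex_line_top hΦ₀.1) with hχq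
  obtain ⟨P₁, hP₁Φ, hP₁0⟩ := exists_ne_zero_mem_line (W := W) hΦ₀.1
  obtain ⟨R₁, hR₁Φ⟩ := exists_not_mem_line (W := W) hΦ₀.1
  have ha' : (a : ZMod p) = ((χl (absGaloisRestrict ℚ K σ₀) : (ZMod p)ˣ) : ZMod p) :=
    intCast_eq_val_quotActionChar bot_stable hΦ₀.2 (relIndex_bot_line hΦ₀.1) hP₁Φ
      (by rwa [AddSubgroup.mem_bot]) _ (fun P hP ↦ by
        rw [AddSubgroup.mem_bot, sub_eq_zero]; exact haΦ P hP)
  have hb' : (b : ZMod p) = ((χq (absGaloisRestrict ℚ K σ₀) : (ZMod p)ˣ) : ZMod p) :=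
    intCast_eq_val_quotActionChar hΦ₀.2 top_stable (relIndex_line_top hΦ₀.1) (AddSubgroup.mem_top R₁) hR₁Φ _
      (fun Q _ ↦ hbΦ Q)
  -- comparison of `res σ₀` with a Frobenius `σ₁` at `𝔓₁ ∣ v`: `res σ₀ = i · g σ₁ g⁻¹`, `i` inertial at `𝔔`
  have compare : ∀ {𝔓₁ : Ideal (absIntegers (𝓞 ℚ) ℚ)}, 𝔓₁ ∈ v.primesAbove → ∀ {σ₁ : absoluteGaloisGroup ℚ},
      IsArithFrobAt (𝓞 ℚ) σ₁ 𝔓₁ →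
      χl (absGaloisRestrict ℚ K σ₀) = χl σ₁ ∧ χq (absGaloisRestrict ℚ K σ₀) = χq σ₁ := by
    intro 𝔓₁ h𝔓₁ σ₁ hσ₁
    obtain ⟨g, hg⟩ := HeightOneSpectrum.exists_smul_eq_of_mem_primesAbove_holds h𝔓₁ h𝔔
    -- `g σ₁ g⁻¹` is a Frobenius at `𝔔 = g • 𝔓₁`
    have hconj : IsArithFrobAt (𝓞 ℚ) (g * σ₁ * g⁻¹) 𝔔 := by
      rw [HeightOneSpectrum.isArithFrobAt_iff_of_mem_primesAbove h𝔔, ← hg]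
      exact (Ideal.forall_conj_smul_sub_pow_mem_smul_iff 𝔓₁ g σ₁ _).mpr
        ((HeightOneSpectrum.isArithFrobAt_iff_of_mem_primesAbove h𝔓₁ σ₁).mp hσ₁)
    -- the inertial discrepancy `i`
    set i : absoluteGaloisGroup ℚ := absGaloisRestrict ℚ K σ₀ * (g * σ₁ * g⁻¹)⁻¹ with hi
    have hiI : i ∈ 𝔔.inertia (absoluteGaloisGroup ℚ) := hres.mul_inv_mem_inertia hconj
    have huni : ∀ Q : geomTorsion W (p : ℤ), i • (i • Q - Q) = i • Q - Q := fun Q ↦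
      FullDescentMultiplicativeUnipotentLine.smul_smul_sub_eq_of_mem_inertia_geomTorsion W hmultv hpp hpv h𝔔 hiI Q
    have hfix := smul_eq_of_unipotent_of_mem_line hΦ₀ huni
    have hl1 : χl i = 1 := quotActionChar_eq_one_of_forall_smul_eq bot_stable hΦ₀.2 (relIndex_bot_line hΦ₀.1) hfix
    have hq1 : χq i = 1 := quotActionChar_eq_one_of_unipotent hΦ₀ huni hfix
    have hdec : absGaloisRestrict ℚ K σ₀ = i * (g * σ₁ * g⁻¹) := by rw [hi, inv_mul_cancel_right]
    constructor
    · rw [hdec, map_mul, hl1, one_mul, map_mul, map_mul, map_inv, mul_inv_cancel_comm]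
    · rw [hdec, map_mul, hq1, one_mul, map_mul, map_mul, map_inv, mul_inv_cancel_comm]
  -- scalars of `σ₁` from the characters
  have hχl_scalar : ∀ σ₁ : absoluteGaloisGroup ℚ, ∀ P ∈ Φ₀,
      σ₁ • P = (((χl σ₁ : (ZMod p)ˣ) : ZMod p).val) • P := fun σ₁ P hP ↦ by
    have h := smul_sub_zsmul_mem bot_stable hΦ₀.2 (relIndex_bot_line hΦ₀.1) σ₁
      (a := ((((χl σ₁ : (ZMod p)ˣ) : ZMod p).val : ℕ) : ℤ)) (by rw [Int.cast_natCast, ZMod.natCast_zmod_val]) hP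
    rw [AddSubgroup.mem_bot, sub_eq_zero, natCast_zsmul] at h
    exact h
  have hχq_scalar : ∀ σ₁ : absoluteGaloisGroup ℚ, ∀ Q : geomTorsion W (p : ℤ),
      σ₁ • Q - (((χq σ₁ : (ZMod p)ˣ) : ZMod p).val) • Q ∈ Φ₀ := fun σ₁ Q ↦ by
    have h := smul_sub_zsmul_mem hΦ₀.2 top_stable (relIndex_line_top hΦ₀.1) σ₁
      (a := ((((χq σ₁ : (ZMod p)ˣ) : ZMod p).val : ℕ) : ℤ)) (by rw [Int.cast_natCast, ZMod.natCast_zmod_val])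
      (AddSubgroup.mem_top Q)
    rwa [natCast_zsmul] at h
  constructor
  · -- SPLIT
    intro hsplit
    have hsplitv : W.HasSplitMultiplicativeReductionAt v := by
      refine (WeierstrassCurve.hasSplitMultiplicativeReductionAtPrime_iff_hasSplitMultiplicativeReductionAt W v).mp ?_
      have key : ∀ (q : ℕ) (hq' : Fact q.Prime), q = ℓ →
          (haveI := hq'; W.HasSplitMultiplicativeReductionAtPrime q) := by
        rintro q hq' rfl; exact hsplit
      exact key _ _ hvℓ
    obtain ⟨𝔓₁, h𝔓₁, σ₁, hσ₁, key⟩ :=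
      LineScalarsAtMultiplicativePlace.exists_frob_lineScalars_of_hasSplitMultiplicativeReductionAt (W := W) hvℓ hℓp hsplitv
    obtain ⟨hcl, hcq⟩ := compare h𝔓₁ hσ₁
    have k := key hΦ₀ (hχl_scalar σ₁) (hχq_scalar σ₁)
    simp only [ZMod.natCast_zmod_val] at k
    rw [ha', hb', hcl, hcq]
    exact k
  · -- NON-SPLIT, `ℓ` odd
    intro hns hℓ2
    obtain ⟨𝔓₁, h𝔓₁, σ₁, hσ₁, key⟩ :=
      LineScalarsAtMultiplicativePlace.exists_frob_lineScalars_of_not_hasSplitMultiplicativeReductionAtPrime (W := W)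
        hvℓ hℓp hℓ2 hmult hns
    obtain ⟨hcl, hcq⟩ := compare h𝔓₁ hσ₁
    have k := key hΦ₀ (hχl_scalar σ₁) (hχq_scalar σ₁)
    simp only [ZMod.natCast_zmod_val] at k
    rw [ha', hb', hcl, hcq]
    exact k

end Frobenius

end Summit.BirchSwinnertonDyer.BirchSwinnertonDyer.Theorems.GoodLatticeResidualPairScalarsAtMultiplicative

end
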